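import Literature.Computability.Cryptography.TreeSigSecurity
import Literature.Computability.Cryptography.HashAndSignOTSIndexed
import Literature.Computability.Cryptography.UOWHFPadding
import Literature.Computability.Cryptography.InaccessibleEntropyUOWHFTree
import Literature.Computability.Cryptography.PseudorandomnessPRFProofs
import Literature.Computability.Cryptography.PseudorandomGeneratorsInjectiveOWF
import HarnessLib

/-!
# The authentication-tree scheme, XIV: the one-time scheme of Theorem 6.4.1 and the assembly

Topic `Literature/Computability/Cryptography`; the last links of Goldreich's Theorem 6.4.1 ("secure signature schemes
exist if and only if one-way functions exist", the hard direction, Rompel 1990) in the tree's vocabulary: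

* the ONE-TIME scheme fed to the authentication tree — hash-and-sign (Construction 6.4.30, `HashSign.schemeQ`) of a
  universal one-way hash family obtained from any one-way function (`HHRVW.exists_isUOWHF_of_OWFExist`,
  Thm. 6.4.29, padded to a polynomial range by `UOWHFPadding.lean`) over Lamport's scheme (Construction 6.4.4) — with
  the bookkeeping the tree needs: polynomial coin budgets, short verification keys, a signer reading only the coins
  of its hash index (`HCS`), signatures of bounded length (`SigBound`): **`exists_treeOTS_of_OWFExist`**;
* **`secureSignaturesExist_of_OWFExist_of_PRFExist`**: one-way functions and pseudorandom functions give EUF-CMA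
  secure signature schemes (Theorem 6.4.9 with Constructions 6.4.16 / 6.4.30 / 6.4.4 and Thm. 6.4.29);
* **`secureSignaturesExist_of_OWFExist_of_HILL`**: granted the Håstad–Impagliazzo–Levin–Luby theorem
  (`PRGExist_iff_OWFExist`, the tree's remaining named fact on this route; pseudorandom functions then come from
  `PRFExist_of_OWFExist_of_HILL`, GGM), the fact `secureSignaturesExist_of_OWFExist` (Theorem 6.4.1, hard direction).

All proved; no named facts.

## References

* O. Goldreich, *Foundations of Cryptography II*, CUP 2004, §6.4: Theorem 6.4.1, Constructions 6.4.4 / 6.4.16 /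
  6.4.30, Prop. 6.4.15 / 6.4.17 / 6.4.31, Theorems 6.4.9 / 6.4.29 / 6.4.32, §6.4.3.4 (the assembly).
* J. Rompel, *One-way functions are necessary and sufficient for secure signatures*, STOC 1990.
* M. Naor, M. Yung, *Universal one-way hash functions and their cryptographic applications*, STOC 1989.
-/

namespace Literature.Computability.Cryptography

open _root_.Computability Complexity Complexity.Brick Polynomial

namespace TreeSigInst

/-! ### The concrete one-time scheme -/

variable (f : List Bool → List Bool) (qI pI P CP : Polynomial ℕ) (H' : HashCollection)

/-- The document length of the Lamport instance: `ℓ(n) = 2 q_I(n) + 2 + P(q_I(n))` (index and padded hash value in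
the pair code). [Goldreich 2004, Construction 6.4.30] [folklore] -/
noncomputable def L : Polynomial ℕ := C 2 * qI + C 2 + P.comp qI

/-- **The one-time scheme of the assembly**: hash-and-sign of `H'` over Lamport's scheme for `f`, with the signer's
coin budget `CP`. [Goldreich 2004, Construction 6.4.30 over Construction 6.4.4] [cite: Goldreich2004, Construction 6.4.30] -/
noncomputable def ots : SignatureScheme := HashSign.schemeQ qI H' (Lamport.scheme f (L qI P)) pI 0 fun N => CP.eval N

variable {f qI pI P CP H'}

/-- `keyGen_run` (bookkeeping). [folklore] -/
theorem keyGen_run (n : ℕ) (c : List Bool) : (ots f qI pI P CP H').keyGen.run n c =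
    (boolPair (ones n) (Lamport.pkOf f (L qI P) n c), boolPair (ones n) (Lamport.skOf n c)) := rfl

/-- `keyGen_coinLen` (bookkeeping). [folklore] -/
theorem keyGen_coinLen (n : ℕ) : (ots f qI pI P CP H').keyGen.coinLen n = 2 * (L qI P).eval n * n := rfl

/-- `sign_coinLen` (bookkeeping). [folklore] -/
theorem sign_coinLen (k : ℕ) : (ots f qI pI P CP H').sign.coinLen k = CP.eval k := rfl

/-- `sign_run` (bookkeeping). [folklore] -/
theorem sign_run (sk' m ρ : List Bool) : (ots f qI pI P CP H').sign.run (sk', m) ρ =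
    boolPair (HashSign.beta1 H' pI sk' ρ) (HashSign.beta2 H' (Lamport.scheme f (L qI P)) pI 0 sk' m ρ) := rfl

/-- **Verification keys are short**: `PK(n) = 4n + 4 + 2 L(n) (2 of(n) + 2)` for an output bound `of` of `f`. [folklore] -/
theorem length_pk_le {of : Polynomial ℕ} (hof : ∀ x, (f x).length ≤ of.eval x.length) (n : ℕ) (c : List Bool) :
    ((ots f qI pI P CP H').keyGen.run n c).1.length ≤ (C 4 * X + C 4 + C 2 * L qI P * (C 2 * of + C 2)).eval n := by
  rw [keyGen_run]
  dsimp only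
  rw [length_boolPair, Lamport.pkOf, length_boolPair]
  have himg : ∀ a ∈ Lamport.images f (L qI P) n c, a.length ≤ of.eval n := by
    intro a ha
    rw [Lamport.images, List.mem_map] at ha
    obtain ⟨t, _, rfl⟩ := ha
    exact (hof _).trans (TM2Iter.eval_mono of (Yao.length_blk_le _ _ _))
  have h := TreeSig.length_encList_le _ himg
  rw [Lamport.images, List.length_map, List.length_range] at h
  rw [Lamport.images]
  simp only [ones, List.length_replicate, eval_add, eval_mul, eval_C, eval_X]
  nlinarith

/-- `fitLen` of a prefix keeps the prefix. [folklore] -/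
theorem take_fitLen_take (ρ : List Bool) (k : ℕ) : (TreeSig.fitLen (ρ.take k) ρ.length).take k = ρ.take k := by
  rw [TreeSig.fitLen, List.take_of_length_le (List.length_take_le' k ρ)]
  rcases le_or_gt k ρ.length with hk | hk
  · have hl : (ρ.take k).length = k := by rw [List.length_take, min_eq_left hk]
    rw [List.take_append_of_le_length (by rw [hl]), List.take_of_length_le (l := ρ.take k) (by rw [hl])]
  · rw [List.take_of_length_le hk.le, Nat.sub_self, List.replicate_zero, List.append_nil, List.take_of_length_le hk.le]

/-- **The signer reads only the coins of its hash index** (`HCS` with `CS = p_I`): it is unchanged when its coins are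
replaced by their first `p_I(n)` bits padded back. [Goldreich 2004, Construction 6.4.30 (the signer draws `β₁ ← I(1ⁿ)`
and signs deterministically)] [folklore] -/
theorem sign_run_eq_fitLen (n : ℕ) (c m ρ : List Bool) :
    (ots f qI pI P CP H').sign.run (((ots f qI pI P CP H').keyGen.run n c).2, m) ρ =
      (ots f qI pI P CP H').sign.run (((ots f qI pI P CP H').keyGen.run n c).2, m) (TreeSig.fitLen (ρ.take (pI.eval n)) ρ.length) := by
  rw [keyGen_run]
  dsimp only
  rw [sign_run, sign_run]
  have hn : (fstF (boolPair (ones n) (Lamport.skOf n c))).length = n := by rw [fstF_boolPair, ones, List.length_replicate]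
  have hb1 : HashSign.beta1 H' pI (boolPair (ones n) (Lamport.skOf n c)) (TreeSig.fitLen (ρ.take (pI.eval n)) ρ.length) =
      HashSign.beta1 H' pI (boolPair (ones n) (Lamport.skOf n c)) ρ := by
    rw [HashSign.beta1, HashSign.beta1, hn, take_fitLen_take]
  rw [hb1, HashSign.beta2, HashSign.beta2, hb1]
  simp [Lamport.scheme]

/-- Keys in the support of the key law come from coins of the prescribed length. [folklore] -/
theorem exists_coins_of_mem_support_keyPMF (S : SignatureScheme) (n : ℕ) {ks : List Bool × List Bool} (h : ks ∈ (S.keyPMF n).support) :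
    ∃ c : List Bool, c.length = S.keyGen.coinLen n ∧ S.keyGen.run n c = ks := by
  have hn : (unaryEncodeNat n).length = n := by rw [Complexity.unaryEncodeNat_eq_replicate, List.length_replicate]
  rw [SignatureScheme.keyPMF, RandAlg.outputPMF, PMF.support_map] at h
  obtain ⟨v, -, hv⟩ := h
  exact ⟨v.toList, by rw [List.Vector.toList_length, hn], hv⟩

/-- Lamport signatures under keys of `G(1ⁿ)` have length `ℓ(n)·n` or `0`. [Goldreich 2004, Construction 6.4.4] [folklore] -/
theorem length_sigOf_le (n : ℕ) {c : List Bool} (hc : c.length = 2 * (L qI P).eval n * n) (m : List Bool) :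
    (Lamport.sigOf (L qI P) (Lamport.skOf n c) m).length ≤ (L qI P).eval n * n := by
  rw [Lamport.sigOf, Lamport.skOf, fstF_boolPair, sndF_boolPair, ones, List.length_replicate]
  split_ifs with hm
  · rw [Lamport.length_ccat_of_eq (n := n) fun t ht => Yao.length_blk_of_le ?_]
    rw [hc]
    have : Lamport.bitIdx m t + 1 ≤ 2 * (L qI P).eval n := by
      rw [Lamport.bitIdx]
      have : (m.getD t false).toNat ≤ 1 := Bool.toNat_le _
      omega
    exact Nat.mul_le_mul_right n this
  · exact Nat.zero_le _

/-- **Signatures are short** (`SigBound` with `PS(n) = 2 q_I(n) + 2 + ℓ(n)·n`): the hash index has length `q_I(n)`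
(indices of the family on `1ⁿ`) and the Lamport signature `ℓ(n)·n`. [Goldreich 2004, Construction 6.4.30] [folklore] -/
theorem sigBound (hCP : ∀ N, pI.eval N ≤ CP.eval N) (hpI : ∀ n, H'.index.coinLen n = pI.eval n)
    (hlen : ∀ n, ∀ s ∈ (H'.indexPMF n).support, s.length = qI.eval n) :
    TreeSig.SigBound (ots f qI pI P CP H') (C 2 * qI + C 2 + L qI P * X) := by
  intro n ks hks m ρ hρ
  obtain ⟨c, hc, rfl⟩ := exists_coins_of_mem_support_keyPMF _ n hks
  rw [keyGen_coinLen] at hc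
  rw [keyGen_run] at hρ ⊢
  dsimp only at hρ ⊢
  rw [sign_run, length_boolPair]
  have hn : (fstF (boolPair (ones n) (Lamport.skOf n c))).length = n := by rw [fstF_boolPair, ones, List.length_replicate]
  -- the index
  have hρge : pI.eval n ≤ ρ.length := by
    rw [hρ, sign_coinLen]
    refine le_trans (TM2Iter.eval_mono pI ?_) (hCP _)
    have : n ≤ (boolPair (ones n) (Lamport.skOf n c)).length := by simp only [length_boolPair, ones, List.length_replicate]; omega
    have h2 := length_fstF_sndF_le (pairCode (boolPair (ones n) (Lamport.skOf n c), m))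
    rw [TreeSig.fstF_pairCode] at h2
    dsimp only at h2
    omega
  have hb1 : (HashSign.beta1 H' pI (boolPair (ones n) (Lamport.skOf n c)) ρ).length = qI.eval n := by
    rw [HashSign.beta1, hn]
    refine hlen n _ ?_
    rw [HashCollection.indexPMF, RandAlg.outputPMF, PMF.support_map]
    have hl : (ρ.take (pI.eval n)).length = H'.index.coinLen (unaryEncodeNat n).length := by
      rw [List.length_take, Complexity.unaryEncodeNat_eq_replicate, List.length_replicate, hpI, min_eq_left hρge]
    exact ⟨⟨ρ.take (pI.eval n), hl⟩, by rw [PMF.support_uniformOfFintype]; exact Set.mem_univ _, rfl⟩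
  -- the Lamport signature
  have hb2 : (HashSign.beta2 H' (Lamport.scheme f (L qI P)) pI 0 (boolPair (ones n) (Lamport.skOf n c)) m ρ).length ≤ (L qI P).eval n * n := by
    rw [HashSign.beta2, sndF_boolPair]
    simp only [Lamport.scheme]
    exact length_sigOf_le n hc _
  simp only [eval_add, eval_mul, eval_C, eval_X]
  omega

end TreeSigInst

/-! ### The one-time scheme from one-way functions -/

/-- **The one-time scheme of Theorem 6.4.1 with its bookkeeping.** From one-way functions: a one-time secure signature
scheme with polynomial coin budgets, short verification keys, a signer reading only the coins of its hash index, and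
signatures of bounded length. [Goldreich 2004, Thm. 6.4.32 (one-time level) via Prop. 6.4.31, Thm. 6.4.29,
Construction 6.4.4] [cite: Goldreich2004, Prop. 6.4.31] -/
theorem exists_treeOTS_of_OWFExist (hOWF : OWFExist) :
    ∃ (S : SignatureScheme) (pG pS CS PK PS : Polynomial ℕ), S.IsOneTimeSecure ∧
      (∀ n, S.keyGen.coinLen n = pG.eval n) ∧ (∀ ℓ, S.sign.coinLen ℓ = pS.eval ℓ) ∧
      (∀ (n : ℕ) (c : List Bool), c.length = pG.eval n → (S.keyGen.run n c).1.length ≤ PK.eval n) ∧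
      (∀ (n : ℕ) (c : List Bool), c.length = pG.eval n → ∀ (m ρ : List Bool),
        ρ.length = S.sign.coinLen (pairCode ((S.keyGen.run n c).2, m)).length →
        S.sign.run ((S.keyGen.run n c).2, m) ρ = S.sign.run ((S.keyGen.run n c).2, m) (TreeSig.fitLen (ρ.take (CS.eval n)) ρ.length)) ∧
      TreeSig.SigBound S PS := by
  obtain ⟨H, ℓ', qI, pI, hH, hpI, hlen⟩ := HHRVW.exists_isUOWHF_of_OWFExist hOWF
  obtain ⟨H', P, hU', hidx⟩ := hH.exists_polyRange
  have hpI' : ∀ n, H'.index.coinLen n = pI.eval n := fun n => by rw [hidx]; exact hpI n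
  have hlen' : ∀ n, ∀ s ∈ (H'.indexPMF n).support, s.length = qI.eval n := fun n s hs => by
    refine hlen n s ?_
    simpa only [HashCollection.indexPMF, hidx] using hs
  obtain ⟨f, hf⟩ := hOWF
  obtain ⟨of, hof⟩ := TreeSig.exists_poly_length_le_of_mem_FP' hf.1
  have hℓ0 : (TreeSigInst.L qI P : Polynomial ℕ) ≠ 0 := fun h => by
    have := congrArg (fun p : Polynomial ℕ => p.eval 0) h
    simp [TreeSigInst.L] at this
  have hS := Lamport.scheme_isRestrictedOneTimeSecure hf hℓ0
  obtain ⟨CP, hCP, hOTS⟩ := HashSign.isOneTimeSecureQ_poly (qI := qI) (H := H') (S := Lamport.scheme f (TreeSigInst.L qI P))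
    (pI := pI) (pS := 0) (pK := C 2 * TreeSigInst.L qI P * X) (ℓ := fun n => (TreeSigInst.L qI P).eval n) (ℓ' := fun m => P.eval m)
    (fun n => by simp [TreeSigInst.L]) hpI' (fun _ => by simp [Lamport.scheme]) (fun n => by simp [Lamport.scheme]; try ring) hlen' hU' hS
  refine ⟨TreeSigInst.ots f qI pI P CP H', C 2 * TreeSigInst.L qI P * X, CP, pI, C 4 * X + C 4 + C 2 * TreeSigInst.L qI P * (C 2 * of + C 2),
    C 2 * qI + C 2 + TreeSigInst.L qI P * X, hOTS, fun n => ?_, fun k => rfl, fun n c _ => TreeSigInst.length_pk_le hof n c,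
    fun n c _ m ρ _ => TreeSigInst.sign_run_eq_fitLen n c m ρ, TreeSigInst.sigBound hCP hpI' hlen'⟩
  rw [TreeSigInst.keyGen_coinLen]
  simp only [eval_mul, eval_C, eval_X]

/-! ### The assembly of Theorem 6.4.1 (hard direction) -/

/-- **One-way functions and pseudorandom functions give EUF-CMA secure signature schemes** (Goldreich 2004,
Theorem 6.4.9 / Theorem 6.4.1 modulo the PRF, which the book takes from one-way functions via HILL + GGM): the
authentication tree (Construction 6.4.16, Prop. 6.4.17) over the hash-and-sign one-time scheme of
`exists_treeOTS_of_OWFExist`. [cite: Goldreich2004, Theorem 6.4.9] -/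
theorem secureSignaturesExist_of_OWFExist_of_PRFExist (hOWF : OWFExist) (hPRF : PRFExist) : SecureSignaturesExist := by
  obtain ⟨S, pG, pS, CS, PK, PS, hOTS, hcG, hcS, hPK, hCS, hSB⟩ := exists_treeOTS_of_OWFExist hOWF
  exact TreeSig.secureSignaturesExist_of_isOneTimeSecure_of_PRFExist S pG pS CS PK PS hOTS hcG hcS hPK hCS hSB hPRF

/-- **Theorem 6.4.1, hard direction, granted HILL**: if pseudorandom generators exist iff one-way functions do
(`PRGExist_iff_OWFExist`, Håstad–Impagliazzo–Levin–Luby 1999 — a named fact of the tree), then one-way functions give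
EUF-CMA secure signature schemes (pseudorandom functions from `PRFExist_of_OWFExist_of_HILL`, GGM).
[Goldreich 2004, Thm. 6.4.1 (§6.4.3.4); Rompel 1990] [cite: Goldreich2004, Theorem 6.4.1] -/
theorem secureSignaturesExist_of_OWFExist_of_HILL (hHILL : PRGExist_iff_OWFExist) : secureSignaturesExist_of_OWFExist :=
  fun hOWF => secureSignaturesExist_of_OWFExist_of_PRFExist hOWF (PRFExist_of_OWFExist_of_HILL hHILL hOWF)

/-- **Unconditionally from an INJECTIVE one-way function**: injective one-way functions give pseudorandom generators
(Blum–Micali–Yao / Goldreich–Levin, `PRGExist_of_exists_injective_OWF`), hence pseudorandom functions (GGM,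
`PRFExist_of_PRGExist_holds`), hence — by the present development — EUF-CMA secure signature schemes.
[Goldreich 2004, Thm. 6.4.1 with Goldreich 2001, Thm. 3.5.12 and §3.6.2] [cite: Goldreich2004, Theorem 6.4.1] -/
theorem secureSignaturesExist_of_exists_injective_OWF (h : ∃ f : List Bool → List Bool, IsOneWay f ∧ Function.Injective f) :
    SecureSignaturesExist := by
  obtain ⟨f, hf, hinj⟩ := h
  exact secureSignaturesExist_of_OWFExist_of_PRFExist ⟨f, hf⟩ (PRFExist_of_PRGExist_holds (PRGExist_of_exists_injective_OWF ⟨f, hf, hinj⟩))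

end Literature.Computability.Cryptography
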